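import Summits.CriticalPhenomena.PercolationContinuityZ3.Theorems.SahiMasterFamilyThreePartitionTypedSliceCert
import HarnessLib

/-!
# Maximal product class {011,122}ᶜ (25 of 27 types — the largest) (all types except 011, 122): certificate data and kernel check, profile `e ∈ τ`
# (unit `prim-master-conj`, gen 34; `--supports stmt-CriticalPhenomena-4575`)

Memo `run/shared/lean/prim/prim-l12/prim-master-conj/POINTWISE.md` §35.6.  The PRODUCT CLASS of types "all but 011, 122" (27-bit mask `134086639` in the
conventions of `…TypedSliceAtoms`); in section language (`𝒳⁰ = {T | T ∖ e ∈ 𝒳} ⊆ 𝒳¹ = {T | T ∪ e ∈ 𝒳}`): (i) `(𝒱¹ ∩ 𝒲¹) ∖ 𝒰¹ ⊆ 𝒱⁰ ∪ 𝒲⁰` and (ii) `𝒰¹ ∩ 𝒱⁰ ∩ 𝒲⁰ ⊆ 𝒰⁰`.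
A MAXIMAL certifiable product class of the gen-33/34 type-space bank (LP census kit j208583).  This file: the `e ∈ τ` certificate (integer multipliers),
its side conditions and its kernel check (`decide +kernel`, chunked).  Use with `InK.cert` / `threePartNT_nonneg_of_cert` (`…TypedSliceCert`) or via
the step theorem of `…MaxClass25`.  No `sorry`, standard axioms.  HONEST LABEL: certificate data; proves nothing by itself. [this work]
-/

noncomputable section

open Finset
open scoped symmDiff Classical

namespace Summit.CriticalPhenomena.PercolationContinuityZ3.Theorems.ThreePartition

namespace TypedSlice

/-! ### Product class `xa0` = {011,122}ᶜ (25 of 27 types — the largest): all types except 011, 122 (mask `134086639`) -/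

section MaxClass25B

/-- Atoms of the k2 certificate of `xa0` (scaled by `1`). [this work] -/
def xa0BL : List (ℕ × Atom) :=
  [(1, .kl (some (mk 1 0 0)) 115043766 132379128),
   (1, .kl (some (mk 1 0 1)) 115043766 132379128),
   (1, .kl (some (mk 1 1 0)) 115043766 132379128)]


/-- IH triples of the k2 certificate of `xa0`. [this work] -/
def xa0BI : List (ℕ × Ty × Ty × Ty) :=
  [(1, mk 0 0 1, mk 0 1 0, mk 1 0 0), (1, mk 0 0 1, mk 0 2 0, mk 1 0 0), (1, mk 0 0 2, mk 0 1 0, mk 1 0 0)]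


/-- Side conditions (B). [this work] -/
theorem xa0B_ok : certOK xa0BL = true := by
  decide +kernel


/-- Certificate (B), part 1/2. [this work] -/
theorem xa0B_check1 : checkL (inM 134086639) (certResid true 1 xa0BL xa0BI) [mk 0 0 0, mk 0 0 1, mk 0 0 2, mk 0 1 0, mk 0 1 1, mk 0 1 2, mk 0 2 0, mk 0 2 1, mk 0 2 2, mk 1 0 0, mk 1 0 1] = true := by
  decide +kernel


/-- Certificate (B), part 2/2. [this work] -/
theorem xa0B_check2 : checkL (inM 134086639) (certResid true 1 xa0BL xa0BI) [mk 1 0 2, mk 1 1 0, mk 1 1 1, mk 1 1 2, mk 1 2 0, mk 1 2 1, mk 1 2 2, mk 2 0 0, mk 2 0 1, mk 2 0 2, mk 2 1 0, mk 2 1 1, mk 2 1 2, mk 2 2 0, mk 2 2 1, mk 2 2 2] = true := by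
  decide +kernel


/-- Certificate (B) is valid (assembled). [this work] -/
theorem xa0B_check : check (inM 134086639) (certResid true 1 xa0BL xa0BI) = true := by
  have ht : tyList = [mk 0 0 0, mk 0 0 1, mk 0 0 2, mk 0 1 0, mk 0 1 1, mk 0 1 2, mk 0 2 0, mk 0 2 1, mk 0 2 2, mk 1 0 0, mk 1 0 1] ++ [mk 1 0 2, mk 1 1 0, mk 1 1 1, mk 1 1 2, mk 1 2 0, mk 1 2 1, mk 1 2 2, mk 2 0 0, mk 2 0 1, mk 2 0 2, mk 2 1 0, mk 2 1 1, mk 2 1 2, mk 2 2 0, mk 2 2 1, mk 2 2 2] := by decide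
  rw [check, ht, checkL_append, xa0B_check1, xa0B_check2]
  rfl


end MaxClass25B

end TypedSlice

end Summit.CriticalPhenomena.PercolationContinuityZ3.Theorems.ThreePartition
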